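import Summits.AtomisticToContinuum.Crystallization.Theorems.RadialDefectsVanish.Negative.NearGroundStates

/-!
# Crux `GappedShellCensus.RadialDefectsVanish` (stmt-AtomisticToContinuum-15930) — negative lemmas, gen 2:
# minimality is load-bearing (II: energy and good-site count of the mixture witness)

Crux disprover (cdisprove gen 2); dossier `Cruxes/RadialDefectsVanish/Disproof.lean` §6.
* `interactionEnergy_mix_le : E(mix K M) ≤ (K + (20/21)⁶)·E(⌊M/(K+1)⌋)` (cross-copy terms `≤ 0`,
  dilation covariance).
* `card_good_mix_le` — at EVERY scale `a ∈ (0, 1]` at most `K·⌊M/(K+1)⌋` of the `M` sites of the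
  mixture are gapped-twelve (good sites of the undilated copies are good sites of `x^N` at `a`, those of
  the dilated copy at the EXCLUSIVE scale `(20/21)a`; the two good sets of `x^N` are disjoint,
  `card_good_add_card_good_le`); `le_natCard_bad_mix : M/(K+1) ≤ #bad`.
-/

noncomputable section

open scoped Classical
open Filter
open Literature.MathematicalPhysics.StatisticalMechanics
open Summit.AtomisticToContinuum.Crystallization.Theses.GappedShellCensus
open Summit.AtomisticToContinuum.Crystallization.Theorems.ChargedEnergyGapNegative (eStar card_mul_eStar_le
  crysEnergyLimit eStar_le_groundStateEnergy_div e0 norm_e0 e0_ne_zero dimer dimer_injective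
  interactionEnergy_dimer groundStateEnergy_nonpos)
open Summit.AtomisticToContinuum.Crystallization.Theorems.SlackRigidityNegative (gs gs_isGroundState)

namespace Summit.AtomisticToContinuum.Crystallization.Theorems.RadialDefectsVanish.Negative

variable {K N r : ℕ}

/-- Cross-slot pair terms are `≤ 0` (distance `≥ 2 ≥ 1`). [folklore] -/
theorem lj_w_nonpos_of_slot_ne {α β : Idx K N r} (h : slot α ≠ slot β) :
    lennardJones (dist (w K N r α) (w K N r β)) ≤ 0 :=
  lennardJones_nonpos (by linarith [two_le_dist_w (K := K) (N := N) (r := r) h])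

/-- Only the extra `t` itself sits in the slot of the extra `t`. [folklore] -/
theorem slot_eq_slot_inr_iff {β : Idx K N r} {t : Fin r} :
    slot β = slot (Sum.inr t : Idx K N r) ↔ β = Sum.inr t := by
  constructor
  · intro hs
    rcases β with ⟨q', s'⟩ | t'
    · simp only [slot_inl, slot_inr] at hs; have := q'.2; omega
    · simp only [slot_inr] at hs; rw [Fin.ext (by omega : (t' : ℕ) = t)]
  · rintro rfl; rfl

/-- The site sum of an isolated extra is `≤ 0`. [folklore] -/
theorem sum_lj_w_inr_nonpos (t : Fin r) :
    ∑ β, lennardJones (dist (w K N r (Sum.inr t)) (w K N r β)) ≤ 0 := by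
  refine Finset.sum_nonpos fun β _ => ?_
  by_cases hβ : β = Sum.inr t
  · rw [hβ, dist_self, lennardJones_zero]
  · exact lj_w_nonpos_of_slot_ne fun hs => hβ (slot_eq_slot_inr_iff.1 hs.symm)

/-- The site sum of a copy point is at most its in-copy site sum. [folklore] -/
theorem sum_lj_w_inl_le (q : Fin (K + 1)) (s : Fin N) :
    ∑ β, lennardJones (dist (w K N r (Sum.inl (q, s))) (w K N r β)) ≤
      ∑ s', lennardJones (scale K q * dist (gs N s) (gs N s')) := by
  rw [Fintype.sum_sum_type]
  have h2 : ∑ t : Fin r, lennardJones (dist (w K N r (Sum.inl (q, s))) (w K N r (Sum.inr t))) ≤ 0 :=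
    Finset.sum_nonpos fun t _ => lj_w_nonpos_of_slot_ne (by
      simp only [slot_inl, slot_inr]; have := q.2; omega)
  have h1 : ∑ p : Fin (K + 1) × Fin N,
      lennardJones (dist (w K N r (Sum.inl (q, s))) (w K N r (Sum.inl p))) ≤
      ∑ s', lennardJones (scale K q * dist (gs N s) (gs N s')) := by
    rw [Fintype.sum_prod_type, ← Finset.add_sum_erase _ _ (Finset.mem_univ q)]
    have hrest : ∑ q' ∈ Finset.univ.erase q, ∑ s',
        lennardJones (dist (w K N r (Sum.inl (q, s))) (w K N r (Sum.inl (q', s')))) ≤ 0 := by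
      refine Finset.sum_nonpos fun q' hq' => Finset.sum_nonpos fun s' _ => ?_
      have hne : q' ≠ q := Finset.ne_of_mem_erase hq'
      exact lj_w_nonpos_of_slot_ne (by
        simp only [slot_inl]; exact fun h => hne (Fin.ext h).symm)
    have heq : ∑ s', lennardJones (dist (w K N r (Sum.inl (q, s))) (w K N r (Sum.inl (q, s')))) =
        ∑ s', lennardJones (scale K q * dist (gs N s) (gs N s')) :=
      Finset.sum_congr rfl fun s' _ => by rw [dist_w_inl_inl]
    linarith
  linarith

/-- The full double sum of the mixture is at most the sum of the in-copy double sums. [folklore] -/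
theorem sum_sum_lj_w_le :
    ∑ α, ∑ β, lennardJones (dist (w K N r α) (w K N r β)) ≤
      ∑ q : Fin (K + 1), ∑ s, ∑ s', lennardJones (scale K q * dist (gs N s) (gs N s')) := by
  rw [Fintype.sum_sum_type]
  have hinr : ∑ t : Fin r, ∑ β, lennardJones (dist (w K N r (Sum.inr t)) (w K N r β)) ≤ 0 :=
    Finset.sum_nonpos fun t _ => sum_lj_w_inr_nonpos t
  have hinl : ∑ p : Fin (K + 1) × Fin N, ∑ β, lennardJones (dist (w K N r (Sum.inl p)) (w K N r β)) ≤
      ∑ q : Fin (K + 1), ∑ s, ∑ s', lennardJones (scale K q * dist (gs N s) (gs N s')) := by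
    rw [Fintype.sum_prod_type]
    exact Finset.sum_le_sum fun q _ => Finset.sum_le_sum fun s _ => sum_lj_w_inl_le q s
  linarith

/-- The in-copy double sum at dilation `c` is twice the energy of the dilated ground state. [folklore] -/
theorem sum_sum_lj_smul {c : ℝ} (hc : 0 ≤ c) :
    ∑ s, ∑ s', lennardJones (c * dist (gs N s) (gs N s')) =
      2 * interactionEnergy lennardJones (fun s => c • gs N s) := by
  rw [two_mul_interactionEnergy_eq_sum_sum lennardJones lennardJones_zero]
  simp only [dist_smul₀, Real.norm_of_nonneg hc]

/-- Each copy contributes at most `2·c⁻⁶·E(N)`. [folklore] -/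
theorem copy_bound (q : Fin (K + 1)) :
    ∑ s, ∑ s', lennardJones (scale K q * dist (gs N s) (gs N s')) ≤
      2 * ((scale K q)⁻¹ ^ 6 * groundStateEnergy lennardJones 3 N) := by
  rw [sum_sum_lj_smul (scale_pos K q).le, ← (gs_isGroundState N).2]
  have := interactionEnergy_smul_le (gs N) (one_le_scale K q)
  linarith

/-- `Σ_q c_q⁻⁶ = K + (20/21)⁶`. [folklore] -/
theorem sum_scale_inv_pow (K : ℕ) : ∑ q : Fin (K + 1), (scale K q)⁻¹ ^ 6 = K + dil⁻¹ ^ 6 := by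
  rw [Fin.sum_univ_castSucc]
  simp [scale_castSucc, scale_last]

/-- Twice the energy of the witness is the full double sum over the index type. [folklore] -/
theorem two_mul_interactionEnergy_mix (K M : ℕ) :
    2 * interactionEnergy lennardJones (mix K M) =
      ∑ α, ∑ β, lennardJones (dist (w K (nBlk K M) (nRem K M) α) (w K (nBlk K M) (nRem K M) β)) := by
  rw [two_mul_interactionEnergy_eq_sum_sum lennardJones lennardJones_zero]
  simp only [mix, Function.comp_apply]
  rw [Equiv.sum_comp (idxEquiv K M)
    (fun α => ∑ j, lennardJones (dist (w _ _ _ α) (w _ _ _ (idxEquiv K M j))))]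
  exact Finset.sum_congr rfl fun α _ =>
    Equiv.sum_comp (idxEquiv K M) (fun β => lennardJones (dist (w _ _ _ α) (w _ _ _ β)))

/-- **Energy of the witness**: `E(mix) ≤ (K + (20/21)⁶)·E(⌊M/(K+1)⌋)`. [folklore] -/
theorem interactionEnergy_mix_le (K M : ℕ) :
    interactionEnergy lennardJones (mix K M) ≤
      (K + dil⁻¹ ^ 6) * groundStateEnergy lennardJones 3 (nBlk K M) := by
  have h := two_mul_interactionEnergy_mix K M
  have h1 := sum_sum_lj_w_le (K := K) (N := nBlk K M) (r := nRem K M)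
  have h2 : ∑ q : Fin (K + 1), ∑ s, ∑ s',
      lennardJones (scale K q * dist (gs (nBlk K M) s) (gs (nBlk K M) s')) ≤
      ∑ q : Fin (K + 1), 2 * ((scale K q)⁻¹ ^ 6 * groundStateEnergy lennardJones 3 (nBlk K M)) :=
    Finset.sum_le_sum fun q _ => copy_bound q
  rw [← Finset.mul_sum, ← Finset.sum_mul, sum_scale_inv_pow] at h2
  linarith

/-- `GoodAt` is invariant under re-indexing along an equivalence. [folklore] -/
theorem goodAt_comp_equiv {ι ι' : Type*} [Fintype ι] [DecidableEq ι] [Fintype ι'] [DecidableEq ι']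
    (e : ι' ≃ ι) (v : ι → (EuclideanSpace ℝ (Fin 3))) (a : ℝ) (i : ι') : GoodAt a (v ∘ e) i ↔ GoodAt a v (e i) := by
  unfold GoodAt
  have hc : (Finset.univ.filter fun j : ι' =>
      j ≠ i ∧ dist ((v ∘ e) i) ((v ∘ e) j) ≤ a * (1 + 1 / 50)).card =
      (Finset.univ.filter fun β : ι => β ≠ e i ∧ dist (v (e i)) (v β) ≤ a * (1 + 1 / 50)).card := by
    refine Finset.card_equiv e fun j => ?_
    simp only [Finset.mem_filter, Finset.mem_univ, true_and, Function.comp_apply,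
      e.injective.ne_iff]
  rw [hc]
  refine and_congr_right fun _ => ⟨fun h β hβ => ?_, fun h j hj => ?_⟩
  · have := h (e.symm β) (fun h' => hβ (by rw [← h', e.apply_symm_apply]))
    simpa using this
  · exact h (e j) (e.injective.ne_iff.2 hj)

/-- Scale exclusivity for `GoodAt`. -/
theorem not_goodAt_of_goodAt {ι : Type*} [Fintype ι] [DecidableEq ι] {v : ι → (EuclideanSpace ℝ (Fin 3))} {α : ι} {a a' : ℝ}
    (h1 : a * (1 + 1 / 50) < a' * (1 - 1 / 50)) (h2 : a' * (1 + 1 / 50) < a * (63 / 50))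
    (h : GoodAt a' v α) : ¬ GoodAt a v α := by
  rintro ⟨-, hfar⟩
  obtain ⟨hcard, hfar'⟩ := h
  have hne : (Finset.univ.filter fun β : ι => β ≠ α ∧ dist (v α) (v β) ≤ a' * (1 + 1 / 50)).Nonempty := by
    rw [← Finset.card_pos, hcard]; norm_num
  obtain ⟨β, hβ⟩ := hne
  simp only [Finset.mem_filter, Finset.mem_univ, true_and] at hβ
  obtain ⟨hβα, hd⟩ := hβ
  obtain ⟨hlo, -⟩ := hfar' β hβα
  obtain ⟨-, hor⟩ := hfar β hβα
  rcases hor with h | h <;> linarith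

/-- At two exclusive scales the good sets are disjoint, so their sizes add up to at most `#ι`. -/
theorem card_good_add_card_good_le {ι : Type*} [Fintype ι] [DecidableEq ι] (v : ι → (EuclideanSpace ℝ (Fin 3))) {a a' : ℝ}
    (h1 : a * (1 + 1 / 50) < a' * (1 - 1 / 50)) (h2 : a' * (1 + 1 / 50) < a * (63 / 50)) :
    (Finset.univ.filter fun α => GoodAt a v α).card + (Finset.univ.filter fun α => GoodAt a' v α).card ≤
      Fintype.card ι := by
  rw [← Finset.card_union_of_disjoint]
  · exact Finset.card_le_univ _
  · rw [Finset.disjoint_filter]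
    exact fun α _ ha ha' => not_goodAt_of_goodAt h1 h2 ha' ha

/-- An isolated extra is never good (its bond shell is empty; `a ≤ 1`). -/
theorem not_goodAt_w_inr {a : ℝ} (ha : a ≤ 1) (t : Fin r) : ¬ GoodAt a (w K N r) (Sum.inr t) := by
  rintro ⟨hcard, -⟩
  have hempty : (Finset.univ.filter fun β : Idx K N r =>
      β ≠ Sum.inr t ∧ dist (w K N r (Sum.inr t)) (w K N r β) ≤ a * (1 + 1 / 50)) = ∅ := by
    refine Finset.filter_eq_empty_iff.mpr ?_
    rintro β - ⟨hβ, hd⟩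
    have h2 := two_le_dist_w (K := K) (N := N) (r := r) (α := Sum.inr t) (β := β)
      (fun hs => hβ (slot_eq_slot_inr_iff.1 hs.symm))
    nlinarith
  rw [hempty, Finset.card_empty] at hcard
  exact absurd hcard (by norm_num)

/-- **A good site of copy `q` of the mixture is a good site of the ground state at the undilated
scale `a / scale`** (far copies neither enter the `1.02a`-ball nor the annulus: they are `≥ 2` away). -/
theorem goodAt_gs_of_goodAt_w {a : ℝ} (ha1 : a ≤ 1) {q : Fin (K + 1)} {s : Fin N}
    (h : GoodAt a (w K N r) (Sum.inl (q, s))) : GoodAt (a / scale K q) (gs N) s := by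
  obtain ⟨hcard, hfar⟩ := h
  have hc : 0 < scale K q := scale_pos K q
  refine ⟨?_, fun s' hs' => ?_⟩
  · rw [← hcard]
    refine Finset.card_bij (fun s' _ => (Sum.inl (q, s') : Idx K N r)) ?_ ?_ ?_
    · intro s' hs'
      simp only [Finset.mem_filter, Finset.mem_univ, true_and] at hs' ⊢
      refine ⟨by simpa using hs'.1, ?_⟩
      rw [dist_w_inl_inl]
      have := hs'.2
      rw [div_mul_eq_mul_div, le_div_iff₀ hc] at this
      linarith
    · intro s₁ _ s₂ _ h
      simpa using h
    · intro β hβ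
      simp only [Finset.mem_filter, Finset.mem_univ, true_and] at hβ
      obtain ⟨hβα, hd⟩ := hβ
      have hslot : slot β = slot (Sum.inl (q, s) : Idx K N r) := by
        by_contra hs
        have h2 := two_le_dist_w (K := K) (N := N) (r := r) (Ne.symm hs)
        nlinarith
      rcases β with ⟨q', s'⟩ | t
      · simp only [slot_inl] at hslot
        have hq : q' = q := Fin.ext hslot
        subst hq
        refine ⟨s', ?_, rfl⟩
        simp only [Finset.mem_filter, Finset.mem_univ, true_and]
        refine ⟨fun h => hβα (by rw [h]), ?_⟩
        rw [dist_w_inl_inl] at hd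
        rw [div_mul_eq_mul_div, le_div_iff₀ hc]
        linarith
      · exact absurd (slot_eq_slot_inr_iff.1 hslot.symm) (by simp)
  · have hne : (Sum.inl (q, s') : Idx K N r) ≠ Sum.inl (q, s) := by simpa using hs'
    obtain ⟨hlo, hor⟩ := hfar _ hne
    rw [dist_w_inl_inl] at hlo hor
    refine ⟨?_, ?_⟩
    · rw [div_mul_eq_mul_div, div_le_iff₀ hc]
      linarith
    · rcases hor with h | h
      · left
        rw [div_mul_eq_mul_div, le_div_iff₀ hc]
        linarith
      · right
        rw [div_mul_eq_mul_div, div_le_iff₀ hc]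
        linarith

/-- `#{q : Fin (K+1) | q < K} = K`. [folklore] -/
theorem card_filter_val_lt (K : ℕ) :
    (Finset.univ.filter fun q : Fin (K + 1) => (q : ℕ) < K).card = K := by
  have : (Finset.univ.filter fun q : Fin (K + 1) => (q : ℕ) < K) = Finset.univ.erase (Fin.last K) := by
    ext q
    simp only [Finset.mem_filter, Finset.mem_univ, true_and, Finset.mem_erase, and_true, ne_eq,
      Fin.ext_iff, Fin.val_last]
    have := q.2
    omega
  rw [this, Finset.card_erase_of_mem (Finset.mem_univ _), Finset.card_univ, Fintype.card_fin]
  omega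

/-- **At every scale `a ∈ (0, 1]` at most `K·N` of the `(K+1)·N + r` sites of the mixture are
good**: good sites of the `K` undilated copies are good sites of `x^N` at scale `a`, those of the
dilated copy are good sites of `x^N` at the exclusive scale `(20/21)·a`, and the two good sets of `x^N`
are disjoint. [folklore] -/
theorem card_good_w_le {a : ℝ} (ha0 : 0 < a) (ha1 : a ≤ 1) (hK : 1 ≤ K) :
    (Finset.univ.filter fun α => GoodAt a (w K N r) α).card ≤ K * N := by
  set gA := (Finset.univ.filter fun s => GoodAt a (gs N) s).card with hgA
  set gB := (Finset.univ.filter fun s => GoodAt (a / dil) (gs N) s).card with hgB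
  -- the good set maps into (copies < K) × good(a) ∪ {last} × good(a/dil)
  let emb : Fin (K + 1) × Fin N ↪ Idx K N r := ⟨Sum.inl, Sum.inl_injective⟩
  have hsub : (Finset.univ.filter fun α => GoodAt a (w K N r) α) ⊆
      (((Finset.univ.filter fun q : Fin (K + 1) => (q : ℕ) < K) ×ˢ
          (Finset.univ.filter fun s => GoodAt a (gs N) s)) ∪
        ({Fin.last K} ×ˢ (Finset.univ.filter fun s => GoodAt (a / dil) (gs N) s))).map emb := by
    intro α hα
    simp only [Finset.mem_filter, Finset.mem_univ, true_and] at hα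
    rcases α with ⟨q, s⟩ | t
    · have hg := goodAt_gs_of_goodAt_w (K := K) (N := N) (r := r) ha1 hα
      rw [Finset.mem_map]
      refine ⟨(q, s), ?_, rfl⟩
      rw [Finset.mem_union, Finset.mem_product, Finset.mem_product]
      by_cases hq : (q : ℕ) = K
      · right
        have hql : q = Fin.last K := Fin.ext (by simp [hq])
        have hsc : scale K q = dil := by rw [hql, scale_last]
        rw [hsc] at hg
        exact ⟨by simp [hql], by simpa using hg⟩
      · left
        have hlt : (q : ℕ) < K := lt_of_le_of_ne (Nat.lt_succ_iff.1 q.2) hq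
        have hsc : scale K q = 1 := by simp [scale, hq]
        rw [hsc, div_one] at hg
        exact ⟨by simpa using hlt, by simpa using hg⟩
    · exact absurd hα (not_goodAt_w_inr ha1 t)
  have h1 := Finset.card_le_card hsub
  rw [Finset.card_map] at h1
  have h2 := Finset.card_union_le
    ((Finset.univ.filter fun q : Fin (K + 1) => (q : ℕ) < K) ×ˢ (Finset.univ.filter fun s => GoodAt a (gs N) s))
    ({Fin.last K} ×ˢ (Finset.univ.filter fun s => GoodAt (a / dil) (gs N) s))
  rw [Finset.card_product, Finset.card_product, card_filter_val_lt, Finset.card_singleton, one_mul,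
    ← hgA, ← hgB] at h2
  -- exclusivity of a/dil and a
  have hexcl := card_good_add_card_good_le (gs N) (a := a / dil) (a' := a)
    (by rw [dil]; nlinarith) (by rw [dil]; nlinarith)
  rw [← hgB, ← hgA, Fintype.card_fin] at hexcl
  have hA : gA ≤ N := by
    have := Finset.card_filter_le (Finset.univ : Finset (Fin N)) (fun s => GoodAt a (gs N) s)
    rwa [Finset.card_univ, Fintype.card_fin] at this
  obtain ⟨K', rfl⟩ : ∃ K', K = K' + 1 := ⟨K - 1, by omega⟩
  have : (K' + 1) * gA + gB ≤ (K' + 1) * N := by nlinarith [Nat.mul_le_mul_left K' hA]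
  omega

/-- Hence at most `K·⌊M/(K+1)⌋` sites of `mix K M` are good at any scale `a ∈ (0, 1]`. -/
theorem card_good_mix_le {a : ℝ} (ha0 : 0 < a) (ha1 : a ≤ 1) (hK : 1 ≤ K) (M : ℕ) :
    (Finset.univ.filter fun i : Fin M => GoodAt a (mix K M) i).card ≤ K * nBlk K M := by
  have : (Finset.univ.filter fun i : Fin M => GoodAt a (mix K M) i).card =
      (Finset.univ.filter fun α => GoodAt a (w K (nBlk K M) (nRem K M)) α).card := by
    refine Finset.card_equiv (idxEquiv K M) fun i => ?_
    simp only [Finset.mem_filter, Finset.mem_univ, true_and]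
    exact goodAt_comp_equiv (idxEquiv K M) _ a i
  rw [this]
  exact card_good_w_le ha0 ha1 hK

/-- The number of BAD sites of `mix K M` is at least `M − K·⌊M/(K+1)⌋ ≥ M/(K+1)`. -/
theorem le_natCard_bad_mix {a : ℝ} (ha0 : 0 < a) (ha1 : a ≤ 1) (hK : 1 ≤ K) (M : ℕ) :
    (M : ℝ) / (K + 1) ≤ Nat.card {i : Fin M // ¬ GoodAt a (mix K M) i} := by
  have hgood := card_good_mix_le (K := K) ha0 ha1 hK M
  have hbad : Nat.card {i : Fin M // ¬ GoodAt a (mix K M) i} + 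
      (Finset.univ.filter fun i : Fin M => GoodAt a (mix K M) i).card = M := by
    rw [Nat.card_eq_fintype_card, Fintype.card_subtype, Finset.filter_not,
      Finset.card_sdiff_add_card_eq_card (Finset.filter_subset _ _), Finset.card_univ, Fintype.card_fin]
  have hN : (K + 1) * nBlk K M ≤ M := by
    have := nBlk_spec K M; omega
  have h1 : (M : ℝ) ≤ (K + 1) * (Nat.card {i : Fin M // ¬ GoodAt a (mix K M) i} : ℝ) := by
    have : M ≤ (K + 1) * Nat.card {i : Fin M // ¬ GoodAt a (mix K M) i} := by nlinarith
    exact_mod_cast this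
  rw [div_le_iff₀ (by positivity)]
  linarith

end Summit.AtomisticToContinuum.Crystallization.Theorems.RadialDefectsVanish.Negative

end
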